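import Mathlib

/-!
# Order growth of a derivation with values in `𝔪²` (cards A/B of ideator res-L1-w45c-idea-1, first checkable steps)

(crux stmt-ResolutionOfSingularities-15640 `WildQuotients.WildQuotientResolution`, R-lane of
`L/w45c/CHAIN.md` v8: ideator res-L1-w45c-idea-1, cards A `clean-multiplicative-zeros` and B
`ef-dichotomy-log-eigenfunction`, stubs `derivation_eq_zero_of_pClosed_unit_of_linearPart_zero` (card A
stub 1, "order-growth engine") and `no_unit_logDerivative_of_order_two` (card B stub 1) of
`L/res-L1-w45c-idea-1/Sketch-L1-idea-1.lean` v6; R-lane default of this seat announced on STATUS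
2026-08-27T10:16Z after plan-1's 09:38:47Z naming of the idea-1 S-stubs.
[OURS · L1 W4.5c] — NOT a statement of any manuscript; replaces the role of no printed item.)

Pure commutative algebra (Mathlib only), def-free.
* `CardAB.apply_mem_pow_succ` — the ORDER-GROWTH ENGINE: a derivation `θ` of a commutative ring with
  `θ(R) ⊆ I` and `θ(I) ⊆ I²` maps `Iⁿ` into `Iⁿ⁺¹` for every `n` (Leibniz rule, induction on `n`);
  `CardAB.iterate_apply_mem_pow_add` — hence `θ^[k](Iⁿ) ⊆ Iⁿ⁺ᵏ`.
* `CardAB.derivation_eq_zero_of_pClosed_unit_of_linearPart_zero` (card A stub 1, VERBATIM binders): on a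
  Noetherian local ring, a derivation vanishing at the closed point (`θ R ⊆ 𝔪`) with zero linear part
  (`θ 𝔪 ⊆ 𝔪²`) which is `p`-closed with a UNIT character (`θ^[p] = h·θ`, `h ∈ Rˣ`, `p ≥ 2`) vanishes
  on `𝔪`: `θ b ∈ 𝔪ᴺ ⇒ h θ b = θ^[p] b ∈ 𝔪ᴺ⁺ᵖ⁻¹ ⇒ θ b ∈ 𝔪ᴺ⁺¹`, so `θ b ∈ ⋂ 𝔪ᴺ = 0` (Krull).
* `CardAB.no_unit_logDerivative_of_order_two` (card B stub 1; the idle residue-field hypothesis `hres` of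
  the idea card is dropped, the base ring of the derivation is any commutative ring): on a discrete
  valuation ring, a derivation with `θ(R) ⊆ 𝔪²` satisfies `v(θ r) ≥ v(r) + 1`, so
  `θa·b − a·θb ∈ 𝔪^{v(a)+v(b)+1}` can never equal `−u·a·b` (`u` a unit, `a b ≠ 0`): no unit logarithmic
  derivative at a zero of order `≥ 2`.
-/

-- single-problem summit: the doubled namespace component `ResolutionOfSingularities` is forced
set_option linter.dupNamespace false

open IsLocalRing

namespace Summit.ResolutionOfSingularities.ResolutionOfSingularities.Theorems.WildQuotientResolution.CardAB

variable {S R : Type*} [CommRing S] [CommRing R] [Algebra S R]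

/-- **Order-growth engine**: if `θ(R) ⊆ I` and `θ(I) ⊆ I²` then `θ(Iⁿ) ⊆ Iⁿ⁺¹`. [OURS · L1 W4.5c]
[folklore] -/
theorem apply_mem_pow_succ (θ : Derivation S R R) (I : Ideal R) (h1 : ∀ x, θ x ∈ I)
    (h2 : ∀ x ∈ I, θ x ∈ I ^ 2) : ∀ (n : ℕ), ∀ x ∈ I ^ n, θ x ∈ I ^ (n + 1) := by
  intro n
  induction n with
  | zero => intro x _; simpa using h1 x
  | succ n ih =>
    intro x hx
    rw [pow_succ] at hx
    refine Submodule.mul_induction_on hx ?_ ?_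
    · intro y hy z hz
      rw [Derivation.leibniz, smul_eq_mul, smul_eq_mul]
      refine add_mem ?_ ?_
      · have h := Ideal.mul_mem_mul hy (h2 z hz)
        have e : I ^ (n + 1 + 1) = I ^ n * I ^ 2 := by rw [← pow_add]
        rw [e]
        exact h
      · have h := Ideal.mul_mem_mul hz (ih y hy)
        have e : I ^ (n + 1 + 1) = I * I ^ (n + 1) := by rw [pow_succ']
        rw [e]
        exact h
    · intro y z hy hz
      rw [map_add]
      exact add_mem hy hz

/-- Iterated order growth: `θ^[k](Iⁿ) ⊆ Iⁿ⁺ᵏ` under the hypotheses of `apply_mem_pow_succ`.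
[OURS · L1 W4.5c] [folklore] -/
theorem iterate_apply_mem_pow_add (θ : Derivation S R R) (I : Ideal R) (h1 : ∀ x, θ x ∈ I)
    (h2 : ∀ x ∈ I, θ x ∈ I ^ 2) : ∀ (k n : ℕ), ∀ x ∈ I ^ n, (fun y => θ y)^[k] x ∈ I ^ (n + k) := by
  intro k
  induction k with
  | zero => intro n x hx; simpa using hx
  | succ k ih =>
    intro n x hx
    rw [Function.iterate_succ_apply']
    have h := apply_mem_pow_succ θ I h1 h2 (n + k) _ (ih n x hx)
    have e : n + (k + 1) = n + k + 1 := by omega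
    rw [e]
    exact h

/-- **Card A stub 1 · order-growth engine** (idea-1 `derivation_eq_zero_of_pClosed_unit_of_linearPart_zero`,
binders verbatim): a derivation of a Noetherian local ring with `θ R ⊆ 𝔪`, `θ 𝔪 ⊆ 𝔪²`, `p`-closed with
a unit character `θ^[p] = h·θ` (`p ≥ 2`), vanishes on `𝔪` (Krull intersection theorem).
[OURS · L1 W4.5c] [folklore] -/
theorem derivation_eq_zero_of_pClosed_unit_of_linearPart_zero
    {R : Type} [CommRing R] [IsLocalRing R] [IsNoetherianRing R]
    (θ : Derivation ℤ R R) (p : ℕ) (hp : 2 ≤ p) (h : R) (hh : IsUnit h)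
    (hlaw : ∀ b : R, (fun x => θ x)^[p] b = h * θ b)
    (hm : ∀ b : R, θ b ∈ maximalIdeal R)
    (hlin : ∀ b ∈ maximalIdeal R, θ b ∈ (maximalIdeal R) ^ 2) :
    ∀ b ∈ maximalIdeal R, θ b = 0 := by
  intro b hb
  -- `θ b ∈ 𝔪ᴺ` for every `N ≥ 2`, by induction
  have hall : ∀ N : ℕ, θ b ∈ maximalIdeal R ^ (N + 2) := by
    intro N
    induction N with
    | zero => simpa using hlin b hb
    | succ N ih =>
      -- `h θ b = θ^[p] b = θ^[p-1] (θ b) ∈ 𝔪^(N+2+(p-1))`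
      obtain ⟨q, rfl⟩ : ∃ q, p = q + 1 := ⟨p - 1, by omega⟩
      have h1 : (fun x => θ x)^[q] (θ b) ∈ maximalIdeal R ^ (N + 2 + q) :=
        iterate_apply_mem_pow_add θ (maximalIdeal R) hm hlin q (N + 2) _ ih
      have h2 : h * θ b ∈ maximalIdeal R ^ (N + 2 + q) := by
        rw [← hlaw b, Function.iterate_succ_apply]
        exact h1
      obtain ⟨hu, hhu⟩ := hh.exists_left_inv
      -- multiply by the inverse of the unit `h`
      have h3 : hu * (h * θ b) ∈ maximalIdeal R ^ (N + 2 + q) := Ideal.mul_mem_left _ _ h2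
      rw [← mul_assoc, hhu, one_mul] at h3
      exact Ideal.pow_le_pow_right (by omega) h3
  have hmem : θ b ∈ ⨅ N : ℕ, maximalIdeal R ^ N := by
    refine Ideal.mem_iInf.mpr fun N => ?_
    exact Ideal.pow_le_pow_right (by omega) (hall N)
  rwa [Ideal.iInf_pow_eq_bot_of_isLocalRing _ (maximalIdeal.isMaximal R).ne_top,
    Ideal.mem_bot] at hmem

/-- **Card B stub 1 · no unit logarithmic eigenvalue at a zero of order `≥ 2`** (idea-1
`no_unit_logDerivative_of_order_two`, without its idle hypothesis `hres`): on a discrete valuation ring,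
a derivation with values in `𝔪²` satisfies `θa·b − a·θb ≠ −u·a·b` for `a b ≠ 0` and `u` a unit.
[OURS · L1 W4.5c] [folklore] -/
theorem no_unit_logDerivative_of_order_two {R : Type*} [CommRing R] [IsDomain R]
    [IsDiscreteValuationRing R] [Algebra S R] (θ : Derivation S R R)
    (hθ : ∀ r : R, θ r ∈ (maximalIdeal R) ^ 2) (a b u : R) (ha : a ≠ 0) (hb : b ≠ 0)
    (hu : IsUnit u) : θ a * b - a * θ b ≠ -(u * (a * b)) := by
  obtain ⟨ϖ, hϖ⟩ := IsDiscreteValuationRing.exists_irreducible R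
  have hmax : maximalIdeal R = Ideal.span {ϖ} := hϖ.maximalIdeal_eq
  have hgrow := apply_mem_pow_succ θ (maximalIdeal R)
    (fun x => Ideal.pow_le_self two_ne_zero (hθ x)) (fun x _ => hθ x)
  have hpow : ∀ (k : ℕ) (w : Rˣ), (w : R) * ϖ ^ k ∈ maximalIdeal R ^ k := fun k w => by
    rw [hmax, Ideal.span_singleton_pow]
    exact Ideal.mem_span_singleton.mpr (dvd_mul_left _ _)
  obtain ⟨m, ua, rfl⟩ := IsDiscreteValuationRing.eq_unit_mul_pow_irreducible ha hϖ
  obtain ⟨n, ub, rfl⟩ := IsDiscreteValuationRing.eq_unit_mul_pow_irreducible hb hϖ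
  intro heq
  have hmem : θ (↑ua * ϖ ^ m) * (↑ub * ϖ ^ n) - ↑ua * ϖ ^ m * θ (↑ub * ϖ ^ n) ∈
      maximalIdeal R ^ (m + n + 1) := by
    refine sub_mem ?_ ?_
    · have h := Ideal.mul_mem_mul (hgrow m _ (hpow m ua)) (hpow n ub)
      have e : maximalIdeal R ^ (m + n + 1) = maximalIdeal R ^ (m + 1) * maximalIdeal R ^ n := by
        rw [← pow_add]; congr 1; omega
      rw [e]
      exact h
    · have h := Ideal.mul_mem_mul (hpow m ua) (hgrow n _ (hpow n ub))
      have e : maximalIdeal R ^ (m + n + 1) = maximalIdeal R ^ m * maximalIdeal R ^ (n + 1) := by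
        rw [← pow_add, add_assoc]
      rw [e]
      exact h
  rw [heq, hmax, Ideal.span_singleton_pow, Ideal.mem_span_singleton] at hmem
  have e1 : -(u * (↑ua * ϖ ^ m * (↑ub * ϖ ^ n))) = ϖ ^ (m + n) * -(u * ↑ua * ↑ub) := by ring
  rw [e1, pow_succ] at hmem
  have hdvd : ϖ ∣ -(u * ↑ua * ↑ub) := (mul_dvd_mul_iff_left (pow_ne_zero _ hϖ.ne_zero)).mp hmem
  exact hϖ.not_isUnit (isUnit_of_dvd_unit hdvd ((hu.mul ua.isUnit).mul ub.isUnit).neg)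

end Summit.ResolutionOfSingularities.ResolutionOfSingularities.Theorems.WildQuotientResolution.CardAB
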